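import Summits.ValiantsHypothesis.ValiantsHypothesis.Theorems.PolyaContinuedMonotoneCoverHardCutCount

/-!
# Route `PolyaContinued`, crux `MonotoneCoverHard` (stmt-ValiantsHypothesis-7421), line `few-state-cut`:
# the rectangle count (stub `stub_rectangleBound`) — part 2 of 3

Support file (`--supports stmt-ValiantsHypothesis-7421`).  Abstract form of the stub, over a family
`G` of matchings `τ : Equiv.Perm (Fin m)` that is EDGE-LOCAL (`τ ∈ G ↔ ∀ i, good (i, τ i)`) and
LABEL-BIJECTIVE (the label exponent `d τ = ∑ i, δ (i, τ i)` is injective on `G` with image the set of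
permutation exponents of `S_n`), and a cut `S` that is BALANCED (`n ≤ 3k(τ) ≤ 2n`, `k(τ)` = degree of
the inside part of `d τ`):

* `card_fibre_le` — RECTANGLE BOUND for one crossing state: the members of `G` sharing the state of
  `τ₀` number `≤ k! (n-k)!`, `k = k(τ₀)`.  Proof: for such `τ` the mixed permutations `mix τ τ₀`,
  `mix τ₀ τ` lie in `G`, so `dIn τ + w` and `dOut τ + w'` (`w, w'` the fixed complementary parts of
  `d τ₀`) are permutation exponents of permutations agreeing with `σ₁` (`d τ₀ = pexp σ₁`) on the rows of
  `w`, resp. `w'`; there are `(n - #rows w)! = k!`, resp. `≤ (n-k)!` of those, and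
  `τ ↦ (dIn τ + w, dOut τ + w')` is injective on the fibre by label-injectivity.
* `two_pow_le_card_states` — summing over the states: `n! = #G = Σ_F #fibre_F ≤ N · max k!(n-k)!`,
  and `2^(n/3) k!(n-k)! ≤ n!` for balanced `k` (part 1), so `2^(n/3) ≤ N`.

The objects `d, dIn, dA, dB, dOut, st` are passed as functions together with their defining equations
(no definitions are introduced).  Method: Jerrum–Snir / Nisan rectangle counting [folklore].  VP ≠ VNP is
not moved by this file.
-/

open Finset Equiv

namespace Summit.ValiantsHypothesis.ValiantsHypothesis.Theorems.PolyaContinued.MonotoneCoverHardRectangle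

set_option linter.dupNamespace false

variable {m n : ℕ}

/-! ### The rectangle bound -/

section Rectangle

variable (S : Finset (Fin m ⊕ Fin m)) (δ : Fin m × Fin m → (Fin n × Fin n →₀ ℕ))
  (good : Fin m × Fin m → Prop) (G : Finset (Perm (Fin m)))
  (d dIn dA dB dOut : Perm (Fin m) → (Fin n × Fin n →₀ ℕ))
  (st : Perm (Fin m) → Finset (Fin m × Fin m))

/-- RECTANGLE BOUND for one crossing state: the matchings of a label-injective family `G` sharing
the crossing state of `τ₀` number at most `k! (n-k)!`, `k` = degree of the inside part of `τ₀`. -/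
theorem card_fibre_le (hG : ∀ τ, τ ∈ G ↔ ∀ i, good (i, τ i))
    (hd : ∀ τ, d τ = ∑ i, δ (i, τ i))
    (hdIn : ∀ τ, dIn τ =
      ∑ i ∈ univ.filter (fun i : Fin m => Sum.inl i ∈ S ∧ Sum.inr (τ i) ∈ S), δ (i, τ i))
    (hdA : ∀ τ, dA τ =
      ∑ i ∈ univ.filter (fun i : Fin m => Sum.inl i ∈ S ∧ Sum.inr (τ i) ∉ S), δ (i, τ i))
    (hdB : ∀ τ, dB τ =
      ∑ i ∈ univ.filter (fun i : Fin m => Sum.inl i ∉ S ∧ Sum.inr (τ i) ∈ S), δ (i, τ i))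
    (hdOut : ∀ τ, dOut τ =
      ∑ i ∈ univ.filter (fun i : Fin m => Sum.inl i ∉ S ∧ Sum.inr (τ i) ∉ S), δ (i, τ i))
    (hst : ∀ τ, st τ = (univ.filter fun i : Fin m =>
        (Sum.inl i ∈ S ∧ Sum.inr (τ i) ∉ S) ∨ (Sum.inl i ∉ S ∧ Sum.inr (τ i) ∈ S)).image
          (fun i => (i, τ i)))
    (hinj : ∀ τ ∈ G, ∀ τ' ∈ G, d τ = d τ' → τ = τ')
    (himg : ∀ τ ∈ G, ∃ σ : Perm (Fin n), d τ = ∑ k, Finsupp.single (k, σ k) (1 : ℕ))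
    (τ₀ : Perm (Fin m)) (hτ₀ : τ₀ ∈ G) :
    (G.filter fun τ => st τ = st τ₀).card ≤
      (Finsupp.degree (dIn τ₀)).factorial * (n - Finsupp.degree (dIn τ₀)).factorial := by
  obtain ⟨σ₁, hσ₁⟩ := himg τ₀ hτ₀
  have P1 : ∀ τ, d τ = dIn τ + dA τ + (dB τ + dOut τ) := fun τ => by
    rw [hd, hdIn, hdA, hdB, hdOut]; exact sum_eq_four_parts S δ τ
  have P2 : ∀ τ τ' μ : Perm (Fin m), (∀ i, μ i = if Sum.inl i ∈ S then τ i else τ' i) →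
      d μ = dIn τ + dA τ + (dB τ' + dOut τ') := fun τ τ' μ hμ => by
    rw [hd, hdIn, hdA, hdB, hdOut]; exact sum_mix_eq S δ τ τ' μ hμ
  have P3 : ∀ τ τ', st τ = st τ' → dA τ = dA τ' := fun τ τ' h => by
    rw [hdA, hdA]; rw [hst, hst] at h; exact crossOut_eq_of_state_eq S δ h
  have P3' : ∀ τ τ', st τ = st τ' → dB τ = dB τ' := fun τ τ' h => by
    rw [hdB, hdB]; rw [hst, hst] at h; exact crossIn_eq_of_state_eq S δ h
  have P4 : ∀ τ τ', st τ = st τ' →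
      ∃ μ : Perm (Fin m), ∀ i, μ i = if Sum.inl i ∈ S then τ i else τ' i := fun τ τ' h => by
    rw [hst, hst] at h; exact exists_mix S h
  have P5 : ∀ τ ∈ G, ∀ τ' ∈ G, ∀ μ : Perm (Fin m),
      (∀ i, μ i = if Sum.inl i ∈ S then τ i else τ' i) → μ ∈ G := by
    intro τ hτ τ' hτ' μ hμ
    rw [hG] at hτ hτ' ⊢
    intro i
    rw [hμ i]
    split_ifs
    exacts [hτ i, hτ' i]
  -- the fixed parts of the rectangle through `τ₀`
  set k := Finsupp.degree (dIn τ₀) with hk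
  set w := dA τ₀ + (dB τ₀ + dOut τ₀) with hw
  set w' := dIn τ₀ + dA τ₀ + dB τ₀ with hw'
  have hw0 : dIn τ₀ + w = ∑ k, Finsupp.single (k, σ₁ k) (1 : ℕ) := by
    rw [hw, ← add_assoc, ← P1]; exact hσ₁
  have hw0' : dOut τ₀ + w' = ∑ k, Finsupp.single (k, σ₁ k) (1 : ℕ) := by
    rw [hw', add_comm, add_assoc, ← P1]; exact hσ₁
  set R := w.support.image Prod.fst with hR
  set R' := w'.support.image Prod.fst with hR'
  have hkn : k ≤ n := by have := degree_add_eq_of_add_eq_pexp hw0; omega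
  have hRcard : R.card = n - k := by
    have h1 := card_rows_eq_degree hw0
    have h2 := degree_add_eq_of_add_eq_pexp hw0
    rw [← hR] at h1
    omega
  have hR'card : k ≤ R'.card := by
    have h1 := card_rows_eq_degree hw0'
    rw [← hR'] at h1
    rw [h1, hw', map_add, map_add]
    omega
  -- the injection into pairs of permutation exponents
  let Φ : Perm (Fin m) → (Fin n × Fin n →₀ ℕ) × (Fin n × Fin n →₀ ℕ) :=
    fun τ => (dIn τ + w, dOut τ + w')
  have hΦinj : Set.InjOn Φ ↑(G.filter fun τ => st τ = st τ₀) := by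
    intro τ hτ τ' hτ' hΦ
    rw [Finset.coe_filter] at hτ hτ'
    simp only [Φ, Prod.mk.injEq] at hΦ
    obtain ⟨h1, h2⟩ := hΦ
    have h1' : dIn τ = dIn τ' := add_right_cancel h1
    have h2' : dOut τ = dOut τ' := add_right_cancel h2
    refine hinj τ hτ.1 τ' hτ'.1 ?_
    rw [P1, P1 τ', h1', h2', P3 τ τ₀ hτ.2, P3 τ' τ₀ hτ'.2, P3' τ τ₀ hτ.2, P3' τ' τ₀ hτ'.2]
  have hΦmaps : ∀ τ ∈ G.filter (fun τ => st τ = st τ₀), Φ τ ∈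
      (univ.filter fun σ : Perm (Fin n) => ∀ i ∈ R, σ i = σ₁ i).image
          (fun σ : Perm (Fin n) => ∑ k, Finsupp.single (k, σ k) (1 : ℕ)) ×ˢ
        (univ.filter fun σ : Perm (Fin n) => ∀ i ∈ R', σ i = σ₁ i).image
          (fun σ : Perm (Fin n) => ∑ k, Finsupp.single (k, σ k) (1 : ℕ)) := by
    intro τ hτ
    obtain ⟨hτG, hτst⟩ := Finset.mem_filter.1 hτ
    rw [Finset.mem_product]
    constructor
    · obtain ⟨μ, hμ⟩ := P4 τ τ₀ hτst
      obtain ⟨σ, hσ⟩ := himg μ (P5 τ hτG τ₀ hτ₀ μ hμ)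
      have hμd : dIn τ + w = ∑ k, Finsupp.single (k, σ k) (1 : ℕ) := by
        rw [← hσ, P2 τ τ₀ μ hμ, P3 τ τ₀ hτst, hw, add_assoc]
      exact Finset.mem_image.2 ⟨σ, Finset.mem_filter.2
        ⟨Finset.mem_univ _, mem_agree_of_add_eq_pexp hμd hw0⟩, hμd.symm⟩
    · obtain ⟨μ, hμ⟩ := P4 τ₀ τ hτst.symm
      obtain ⟨σ, hσ⟩ := himg μ (P5 τ₀ hτ₀ τ hτG μ hμ)
      have hμd : dOut τ + w' = ∑ k, Finsupp.single (k, σ k) (1 : ℕ) := by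
        rw [← hσ, P2 τ₀ τ μ hμ, P3' τ τ₀ hτst, hw']; abel
      exact Finset.mem_image.2 ⟨σ, Finset.mem_filter.2
        ⟨Finset.mem_univ _, mem_agree_of_add_eq_pexp hμd hw0'⟩, hμd.symm⟩
  -- count
  calc (G.filter fun τ => st τ = st τ₀).card
        = ((G.filter fun τ => st τ = st τ₀).image Φ).card := (Finset.card_image_of_injOn hΦinj).symm
    _ ≤ ((univ.filter fun σ : Perm (Fin n) => ∀ i ∈ R, σ i = σ₁ i).image
          (fun σ : Perm (Fin n) => ∑ k, Finsupp.single (k, σ k) (1 : ℕ)) ×ˢ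
        (univ.filter fun σ : Perm (Fin n) => ∀ i ∈ R', σ i = σ₁ i).image
          (fun σ : Perm (Fin n) => ∑ k, Finsupp.single (k, σ k) (1 : ℕ))).card := by
      refine Finset.card_le_card fun x hx => ?_
      obtain ⟨τ, hτ, rfl⟩ := Finset.mem_image.1 hx
      exact hΦmaps τ hτ
    _ ≤ (univ.filter fun σ : Perm (Fin n) => ∀ i ∈ R, σ i = σ₁ i).card *
        (univ.filter fun σ : Perm (Fin n) => ∀ i ∈ R', σ i = σ₁ i).card := by
      rw [Finset.card_product]
      exact Nat.mul_le_mul Finset.card_image_le Finset.card_image_le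
    _ = (n - R.card).factorial * (n - R'.card).factorial := by
      rw [card_perm_agree, card_perm_agree, Fintype.card_fin]
    _ ≤ k.factorial * (n - k).factorial :=
      Nat.mul_le_mul (by rw [hRcard, Nat.sub_sub_self hkn]) (Nat.factorial_le (by omega))

/-- THE RECTANGLE BOUND (abstract form): a label-bijective family of matchings with a balanced cut
has at least `2^(n/3)` crossing states. -/
theorem two_pow_le_card_states (hG : ∀ τ, τ ∈ G ↔ ∀ i, good (i, τ i))
    (hd : ∀ τ, d τ = ∑ i, δ (i, τ i))
    (hdIn : ∀ τ, dIn τ =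
      ∑ i ∈ univ.filter (fun i : Fin m => Sum.inl i ∈ S ∧ Sum.inr (τ i) ∈ S), δ (i, τ i))
    (hdA : ∀ τ, dA τ =
      ∑ i ∈ univ.filter (fun i : Fin m => Sum.inl i ∈ S ∧ Sum.inr (τ i) ∉ S), δ (i, τ i))
    (hdB : ∀ τ, dB τ =
      ∑ i ∈ univ.filter (fun i : Fin m => Sum.inl i ∉ S ∧ Sum.inr (τ i) ∈ S), δ (i, τ i))
    (hdOut : ∀ τ, dOut τ =
      ∑ i ∈ univ.filter (fun i : Fin m => Sum.inl i ∉ S ∧ Sum.inr (τ i) ∉ S), δ (i, τ i))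
    (hst : ∀ τ, st τ = (univ.filter fun i : Fin m =>
        (Sum.inl i ∈ S ∧ Sum.inr (τ i) ∉ S) ∨ (Sum.inl i ∉ S ∧ Sum.inr (τ i) ∈ S)).image
          (fun i => (i, τ i)))
    (hinj : ∀ τ ∈ G, ∀ τ' ∈ G, d τ = d τ' → τ = τ')
    (himg : ∀ τ ∈ G, ∃ σ : Perm (Fin n), d τ = ∑ k, Finsupp.single (k, σ k) (1 : ℕ))
    (hsurj : ∀ σ : Perm (Fin n), ∃ τ ∈ G, d τ = ∑ k, Finsupp.single (k, σ k) (1 : ℕ))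
    (hbal : ∀ τ ∈ G, n ≤ 3 * Finsupp.degree (dIn τ) ∧ 3 * Finsupp.degree (dIn τ) ≤ 2 * n) :
    2 ^ (n / 3) ≤ (G.image st).card := by
  have hG1 : n.factorial ≤ G.card := by
    calc n.factorial = (univ : Finset (Perm (Fin n))).card := by
          rw [Finset.card_univ, Fintype.card_perm, Fintype.card_fin]
      _ = ((univ : Finset (Perm (Fin n))).image
            (fun σ : Perm (Fin n) => ∑ k, Finsupp.single (k, σ k) (1 : ℕ))).card :=
          (Finset.card_image_of_injective _ pexp_injective).symm
      _ ≤ (G.image d).card := by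
          refine Finset.card_le_card fun x hx => ?_
          obtain ⟨σ, -, rfl⟩ := Finset.mem_image.1 hx
          obtain ⟨τ, hτ, hτd⟩ := hsurj σ
          exact Finset.mem_image.2 ⟨τ, hτ, hτd⟩
      _ ≤ G.card := Finset.card_image_le
  have hfib : ∀ F ∈ G.image st, (G.filter fun τ => st τ = F).card * 2 ^ (n / 3) ≤ n.factorial := by
    intro F hF
    obtain ⟨τ₀, hτ₀, rfl⟩ := Finset.mem_image.1 hF
    obtain ⟨h1, h2⟩ := hbal τ₀ hτ₀
    calc (G.filter fun τ => st τ = st τ₀).card * 2 ^ (n / 3)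
          ≤ (Finsupp.degree (dIn τ₀)).factorial * (n - Finsupp.degree (dIn τ₀)).factorial *
            2 ^ (n / 3) :=
          Nat.mul_le_mul_right _ (card_fibre_le S δ good G d dIn dA dB dOut st hG hd hdIn hdA hdB
            hdOut hst hinj himg τ₀ hτ₀)
      _ = 2 ^ (n / 3) * ((Finsupp.degree (dIn τ₀)).factorial *
            (n - Finsupp.degree (dIn τ₀)).factorial) := by ring
      _ ≤ n.factorial := two_pow_mul_factorial_le h1 h2
  have key : n.factorial * 2 ^ (n / 3) ≤ n.factorial * (G.image st).card := by
    calc n.factorial * 2 ^ (n / 3) ≤ G.card * 2 ^ (n / 3) := Nat.mul_le_mul_right _ hG1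
      _ = (∑ F ∈ G.image st, (G.filter fun τ => st τ = F).card) * 2 ^ (n / 3) := by
          rw [Finset.card_eq_sum_card_image st G]
      _ = ∑ F ∈ G.image st, (G.filter fun τ => st τ = F).card * 2 ^ (n / 3) :=
          Finset.sum_mul _ _ _
      _ ≤ ∑ F ∈ G.image st, n.factorial := Finset.sum_le_sum hfib
      _ = n.factorial * (G.image st).card := by rw [Finset.sum_const, smul_eq_mul, mul_comm]
  exact Nat.le_of_mul_le_mul_left key (Nat.factorial_pos n)

end Rectangle

end Summit.ValiantsHypothesis.ValiantsHypothesis.Theorems.PolyaContinued.MonotoneCoverHardRectangle
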